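import Summits.KontsevichZagierPeriods.KontsevichZagierPeriods.Theorems.RootDecompRationalCubeDichotomyNashMultiGenP05

/-!
# EtaleCubeBypass — lineage `decomp-kz-lens-2`, generation 10
# (lens: structural dichotomy — special (étale-algebraic) vs generic (Nash))

Route B `RootDecompRationalCubeDichotomy`, `closes (hN : CubeNashNormalForm) (hR : PiRationalisation)
(hA : RationalCubePiKernel) (hC : KontsevichZagierPeriods.Theses.RootDecompRationalCubeDichotomy.PiCancellation)`.  State before this generation: `hN` = crux 24904 is a
THEOREM (shared item 3574, `SymplecticScissors.CubeNashNormalForm.cubeNashNormalForm_proof`, Jung line,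
2026-08-17); `hR` = crux 24903 ⟸ 29430 `NashEtaleCover` (glue + 29429 `PiRationalisationEtale` CLOSED)
⟸ 31659 `NashEtaleLocal` ⟺ 33042 `MultiGenSpecial` (given 33041 PROVED, g9) = Artin–Mazur étale
presentation of ℚ-Nash germs in `≥ 2` variables — the support layer's ENTIRE residual, tagged
IDEA-NEEDED/Lean-XL.

## §1  The node of this generation: a ROUTE-LEVEL BYPASS of the Artin–Mazur residual (kernel-checked)

The route's `closes` consumes `hR : PiRationalisation` ONLY on the finitely many cube integrands `g i`
that `hN` outputs, and the landed glue `piRationalisationGlue_proof` consumes `NashEtaleCover` ONLY on the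
integrand in hand.  Hence the AND-node `CubeNashNormalForm ∧ PiRationalisation` may be replaced by ONE
piece

  `CubeEtaleNormalForm` := the cube–Nash normal form whose output integrands come WITH an étale
  re-presentation on a rational grid (the matrix of `NashEtaleCover`, per integrand),

and `closes_etale : CubeEtaleNormalForm → RationalCubePiKernel → KontsevichZagierPeriods.Theses.RootDecompRationalCubeDichotomy.PiCancellation → KontsevichZagierPeriods`
is proved below from the CLOSED item 29429 alone (per-integrand copy of the landed grid glue).  Edges
(all kernel-checked here): `CubeNashNormalForm → NashEtaleCover → CubeEtaleNormalForm` (so the new piece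
is NOT stronger than the old pair), `CubeEtaleNormalForm → CubeNashNormalForm` (projection), and — since
24904 is a theorem in the tree — `NashEtaleCover → CubeEtaleNormalForm`, `NashEtaleLocal →
KontsevichZagierPeriods` given `hA, hC` (`closes_of_local`).

WHY THIS IS A BYPASS AND NOT A RENAMING.  `NashEtaleCover`/`NashEtaleLocal` quantify over ALL ℚ-Nash
functions near a closed cube (= Artin–Mazur, BCR98 Thm 8.1.5/8.4.4).  `CubeEtaleNormalForm` asks the
étale presentation only of the integrands the RESOLUTION ITSELF PRODUCES: Jacobians `± det DΦ` of the
Jung charts (landed `Literature.NumberTheory.Transcendental.JungPreparation.*`, `…CubeChart*`,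
`…DyadicRamifiedCharts`), i.e. polynomials in coordinates, rational/affine/toric/ramification maps and the
Abhyankar–Jung ROOT FUNCTIONS `w_k` of QUASI-ORDINARY monic polynomials (discriminant = cube-monomial ×
unit, root differences = monomial × unit — landed `AbhyankarJungReal`, `JungRootDifferences`).  For THIS
class the étale presentation is ELEMENTARY (§3, «DESCENT»): Tschirnhaus-centre a root cluster by its mean,
divide by the minimal (comparable) difference monomial — exact monomial division preserves presentedness
(`MonomialDivisionAt`, by RESTRICTION GENERATORS `u(x)|_{xᵢ = c}` and divided differences) — the cluster
then SPLITS at the point, Hensel's factorisation is étale (Jacobian = resultant of coprime factors,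
`HenselEtaleAt`), recurse on cluster size; size 1 is a coefficient.  No normalisation, no excellence, no
Artin approximation.  So the dichotomy special/generic is resolved not by exhausting the generic class
(33042) but by observing that resolution's own output lies in the special class.

## §2  Pointwise multi-generator form (the prover-facing leaf)

`CubePointwiseEtaleNormalForm`: the same with, per integrand, a `MultiGenData` presentation (landed
`…NashMultiGenP01`) at every point of the closed cube; ⟹ `CubeEtaleNormalForm` modulo the kit's
`CollapseAt n` (proved for all `n` in g8 `collapseAt_holds`, landing as part P07) by a per-integrand
Lebesgue-number argument (proved here).

## §3  Typed primitives of the presented-germ calculus (statements; the leaf's stubs)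

`MonomialDivisionAt n`, `HenselEtaleAt`-free formulation `QuasiOrdinaryDescent d` — exact Lean signatures over
`MultiGenData`, elaborating; proofs are the next generation's / the prover's (paper proofs in the docstrings).

Imports ONLY landed modules.  No `sorry`.  Standard axioms.
-/

/-! # `RootDecompRationalCubeDichotomyEtaleCubeBypassP1` — part 1/2 of the mechanical ≤380-line split of `src.lean`
(split by the decomp-kz census seat for landing; mathematics unchanged). -/

noncomputable section

set_option linter.dupNamespace false
set_option linter.unusedVariables false

namespace Summit.KontsevichZagierPeriods.RootDecompRationalCubeDichotomy.Rung24903.EtaleBypass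

open MeasureTheory Set MvPolynomial
open Literature.NumberTheory.Transcendental Literature.NumberTheory.Transcendental.KZ
open Literature.ModelTheory.ExponentialFields (IsSemialgebraic)
open Summit.KontsevichZagierPeriods.KontsevichZagierPeriods.Theses.RootDecompRationalCubeDichotomy
open Summit.KontsevichZagierPeriods.RootDecompRationalCubeDichotomy.RungEtale.Etale
  (piIter_sum piRationalisationGlue_proof piRationalisation_of_nashEtaleCover piRationalisationEtale_proof)
open Summit.KontsevichZagierPeriods.RootDecompRationalCubeDichotomy.Rung27842.SimpleBranch (isSemialgebraic_ratBox)
open Summit.KontsevichZagierPeriods.RootDecompRationalCubeDichotomy.Rung29430.NashEtaleLocalGlue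
  (nashEtaleCover_of_nashEtaleLocal dist_corner_le corner_mem_cube)
open Summit.KontsevichZagierPeriods.RootDecompRationalCubeDichotomy.Rung29430.MultiGen
  (LocalDataAt MultiGenData CollapseAt)

/-! ### §1a  Per-integrand matrices of the route decls -/

/-- The matrix of `NashEtaleCover` for ONE function `g` of `n` variables: a rational grid of mesh `1/N`
and on every grid box an étale re-presentation `g = A(x,h x)/B(x,h x)` by a SIMPLE ℚ-Nash branch `h`. -/
def EtaleCoverAt (n : ℕ) (g : (Fin n → ℝ) → ℝ) : Prop :=
  ∃ N : ℕ, 0 < N ∧ ∀ κ : Fin n → Fin N, ∃ (V : Set (Fin n → ℝ)) (h : (Fin n → ℝ) → ℝ)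
    (F A B : MvPolynomial (Fin (n + 1)) ℚ), IsOpen V ∧
    Set.pi Set.univ (fun i : Fin n => Set.Icc (((κ i : ℕ) : ℝ) / N) ((((κ i : ℕ) : ℝ) + 1) / N)) ⊆ V ∧
    IsSemialgebraicFunOn ℚ V h ∧ AnalyticOnNhd ℝ h V ∧
    (∀ x ∈ Set.pi Set.univ (fun i : Fin n => Set.Icc (((κ i : ℕ) : ℝ) / N) ((((κ i : ℕ) : ℝ) + 1) / N)),
      MvPolynomial.aeval (Fin.snoc x (h x) : Fin (n + 1) → ℝ) F = 0 ∧
      MvPolynomial.aeval (Fin.snoc x (h x) : Fin (n + 1) → ℝ) (MvPolynomial.pderiv (Fin.last n) F) ≠ 0 ∧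
      MvPolynomial.aeval (Fin.snoc x (h x) : Fin (n + 1) → ℝ) B ≠ 0 ∧
      g x = MvPolynomial.aeval (Fin.snoc x (h x) : Fin (n + 1) → ℝ) A /
        MvPolynomial.aeval (Fin.snoc x (h x) : Fin (n + 1) → ℝ) B)

/-- `NashEtaleCover` is `EtaleCoverAt` for every ℚ-Nash `g` near a closed cube (definitional). -/
theorem nashEtaleCover_iff_at :
    NashEtaleCover ↔ ∀ (n : ℕ) (g : (Fin n → ℝ) → ℝ) (U : Set (Fin n → ℝ)), IsOpen U →
      Set.pi Set.univ (fun _ : Fin n => Set.Icc (0:ℝ) 1) ⊆ U → IsSemialgebraicFunOn ℚ U g →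
      AnalyticOnNhd ℝ g U → EtaleCoverAt n g :=
  Iff.rfl

/-- The matrix of `PiRationalisation` for ONE closed-unit-cube representation `s`: from some `K₀` on,
`[π]^K·[s]` lies in `relations ⊔ ⟨rational closed-unit-cube representations⟩`. -/
def PiRatAt (n : ℕ) (s : IntegralRep n) : Prop :=
  ∃ K₀ : ℕ, ∀ K : ℕ, K₀ ≤ K → (fun x : FormalRep => of piRep * x)^[K] (of s) ∈
    relations ⊔ AddSubgroup.closure {x : FormalRep | ∃ (m : ℕ) (q : IntegralRep m)
      (P Q : MvPolynomial (Fin m) ℚ), q.domain = Set.pi Set.univ (fun _ : Fin m => Set.Icc (0:ℝ) 1) ∧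
      (∀ z ∈ Set.pi Set.univ (fun _ : Fin m => Set.Icc (0:ℝ) 1), MvPolynomial.aeval z Q ≠ 0) ∧
      (∀ z ∈ Set.pi Set.univ (fun _ : Fin m => Set.Icc (0:ℝ) 1),
        q.integrand z = MvPolynomial.aeval z P / MvPolynomial.aeval z Q) ∧ x = of q}

/-- `PiRationalisation` is `PiRatAt` for every cube representation with ℚ-Nash integrand (definitional). -/
theorem piRationalisation_iff_at :
    PiRationalisation ↔ ∀ (n : ℕ) (g : (Fin n → ℝ) → ℝ) (U : Set (Fin n → ℝ)) (s : IntegralRep n),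
      IsOpen U → Set.pi Set.univ (fun _ : Fin n => Set.Icc (0:ℝ) 1) ⊆ U → IsSemialgebraicFunOn ℚ U g →
      AnalyticOnNhd ℝ g U → s.domain = Set.pi Set.univ (fun _ : Fin n => Set.Icc (0:ℝ) 1) →
      (∀ z ∈ Set.pi Set.univ (fun _ : Fin n => Set.Icc (0:ℝ) 1), s.integrand z = g z) → PiRatAt n s :=
  Iff.rfl

/-! ### §1b  The per-integrand grid glue (copy of the landed `piRationalisationGlue_proof`, which consumes
`NashEtaleCover` only on the integrand in hand) -/

/-- **Per-integrand glue.** `PiRationalisationEtale` (item 29429) and an étale grid cover of ONE integrand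
`g` give `PiRatAt` for the cube representation with integrand `g`: grid the cube (domain additivity, null
overlaps), treat every box by 29429, `K₀ = max`. [Kontsevich–Zagier 2001 §1.2 rule (1)] -/
theorem piRatAt_of_etaleCoverAt (hE : PiRationalisationEtale) {n : ℕ} {g : (Fin n → ℝ) → ℝ}
    (s : IntegralRep n) (hsd : s.domain = Set.pi Set.univ (fun _ : Fin n => Set.Icc (0:ℝ) 1))
    (hsg : ∀ z ∈ Set.pi Set.univ (fun _ : Fin n => Set.Icc (0:ℝ) 1), s.integrand z = g z)
    (hc : EtaleCoverAt n g) : PiRatAt n s := by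
  obtain ⟨N, hN0, hcov⟩ := hc
  choose V h F A B hV hbV hhs hha hloc using hcov
  have hNpos : (0:ℝ) < N := by exact_mod_cast hN0
  -- the grid of `Nⁿ` rational boxes
  let lo : (Fin n → Fin N) → Fin n → ℚ := fun κ i => ((κ i : ℕ) : ℚ) / N
  let hi : (Fin n → Fin N) → Fin n → ℚ := fun κ i => (((κ i : ℕ) : ℚ) + 1) / N
  let box : (Fin n → Fin N) → Set (Fin n → ℝ) := fun κ =>
    Set.pi Set.univ (fun i : Fin n => Icc ((lo κ i : ℚ) : ℝ) (hi κ i))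
  have hlo : ∀ κ i, ((lo κ i : ℚ) : ℝ) = ((κ i : ℕ) : ℝ) / (N : ℝ) := by intro κ i; simp [lo]
  have hhi : ∀ κ i, ((hi κ i : ℚ) : ℝ) = (((κ i : ℕ) : ℝ) + 1) / (N : ℝ) := by intro κ i; simp [hi]
  have hlohi : ∀ κ i, lo κ i < hi κ i := by
    intro κ i
    exact div_lt_div_of_pos_right (by linarith) (by exact_mod_cast hN0)
  have hboxeq : ∀ κ, box κ =
      Set.pi Set.univ (fun i : Fin n => Set.Icc (((κ i : ℕ) : ℝ) / N) ((((κ i : ℕ) : ℝ) + 1) / N)) := by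
    intro κ
    simp only [box, hlo, hhi]
  have hbox_cube : ∀ κ, box κ ⊆ Set.pi Set.univ (fun _ : Fin n => Set.Icc (0:ℝ) 1) := by
    intro κ x hx
    rw [Set.mem_univ_pi] at hx ⊢
    intro i
    have hxi := hx i
    rw [Set.mem_Icc, hlo, hhi] at hxi
    refine ⟨le_trans (by positivity) hxi.1, le_trans hxi.2 ?_⟩
    rw [div_le_one hNpos]
    have h := (κ i).isLt
    exact_mod_cast Nat.succ_le_of_lt h
  -- every point of the cube lies in a grid box
  have hcover : ∀ x ∈ Set.pi Set.univ (fun _ : Fin n => Set.Icc (0:ℝ) 1), ∃ κ, x ∈ box κ := by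
    intro x hx
    rw [Set.mem_univ_pi] at hx
    refine ⟨fun i => ⟨min ⌊(N:ℝ) * x i⌋₊ (N - 1), by omega⟩, ?_⟩
    rw [Set.mem_univ_pi]
    intro i
    have hx0 : 0 ≤ x i := (hx i).1
    have hx1 : x i ≤ 1 := (hx i).2
    have hfl : (⌊(N:ℝ) * x i⌋₊ : ℝ) ≤ N * x i := Nat.floor_le (by positivity)
    have hfl' : (N:ℝ) * x i < ⌊(N:ℝ) * x i⌋₊ + 1 := Nat.lt_floor_add_one _
    have hcomm : x i * (N:ℝ) = N * x i := mul_comm _ _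
    simp only [Set.mem_Icc, hlo, hhi]
    constructor
    · rw [div_le_iff₀ hNpos]
      have hmin : ((min ⌊(N:ℝ) * x i⌋₊ (N - 1) : ℕ) : ℝ) ≤ ⌊(N:ℝ) * x i⌋₊ := by
        exact_mod_cast min_le_left _ _
      linarith
    · rw [le_div_iff₀ hNpos]
      by_cases hc : ⌊(N:ℝ) * x i⌋₊ ≤ N - 1
      · have hmin : ((min ⌊(N:ℝ) * x i⌋₊ (N - 1) : ℕ) : ℝ) = ⌊(N:ℝ) * x i⌋₊ := by
          rw [min_eq_left hc]
        rw [hmin]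
        linarith
      · push Not at hc
        have hmin : ((min ⌊(N:ℝ) * x i⌋₊ (N - 1) : ℕ) : ℝ) + 1 = N := by
          rw [min_eq_right hc.le, Nat.cast_sub (by omega), Nat.cast_one]; ring
        rw [hmin]
        nlinarith
  -- distinct grid boxes meet in a null set
  have hnull : ∀ κ κ', κ ≠ κ' → volume (box κ ∩ box κ') = 0 := by
    intro κ κ' hne
    obtain ⟨i, hi_ne⟩ := Function.ne_iff.1 hne
    have hset : box κ ∩ box κ' = Set.Icc (fun j => max ((lo κ j : ℚ) : ℝ) ((lo κ' j : ℚ) : ℝ))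
        (fun j => min ((hi κ j : ℚ) : ℝ) ((hi κ' j : ℚ) : ℝ)) := by
      ext x
      simp only [box, Set.mem_inter_iff, Set.mem_univ_pi, Set.mem_Icc, Pi.le_def, max_le_iff, le_min_iff]
      constructor
      · rintro ⟨h1, h2⟩; exact ⟨fun j => ⟨(h1 j).1, (h2 j).1⟩, fun j => ⟨(h1 j).2, (h2 j).2⟩⟩
      · rintro ⟨h1, h2⟩; exact ⟨fun j => ⟨(h1 j).1, (h2 j).1⟩, fun j => ⟨(h1 j).2, (h2 j).2⟩⟩
    rw [hset, Real.volume_Icc_pi]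
    refine Finset.prod_eq_zero (Finset.mem_univ i) ?_
    rw [ENNReal.ofReal_eq_zero]
    simp only [hlo, hhi]
    have hi_ne' : (κ i : ℕ) ≠ (κ' i : ℕ) := fun h => hi_ne (Fin.ext h)
    rcases Nat.lt_or_gt_of_ne hi_ne' with h | h
    · have h1 : ((κ i : ℕ) : ℝ) + 1 ≤ (κ' i : ℕ) := by exact_mod_cast h
      have h2 : (((κ i : ℕ) : ℝ) + 1) / N ≤ ((κ' i : ℕ) : ℝ) / N := div_le_div_of_nonneg_right h1 hNpos.le
      linarith [min_le_left ((((κ i : ℕ) : ℝ) + 1) / N) ((((κ' i : ℕ) : ℝ) + 1) / N),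
        le_max_right (((κ i : ℕ) : ℝ) / N) (((κ' i : ℕ) : ℝ) / N)]
    · have h1 : ((κ' i : ℕ) : ℝ) + 1 ≤ (κ i : ℕ) := by exact_mod_cast h
      have h2 : (((κ' i : ℕ) : ℝ) + 1) / N ≤ ((κ i : ℕ) : ℝ) / N := div_le_div_of_nonneg_right h1 hNpos.le
      linarith [min_le_right ((((κ i : ℕ) : ℝ) + 1) / N) ((((κ' i : ℕ) : ℝ) + 1) / N),
        le_max_left (((κ i : ℕ) : ℝ) / N) (((κ' i : ℕ) : ℝ) / N)]
  -- the pieces: restrictions of `s` to the grid boxes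
  have hbox_dom : ∀ κ, box κ ⊆ s.domain := fun κ => by rw [hsd]; exact hbox_cube κ
  let piece : (Fin n → Fin N) → IntegralRep n := fun κ =>
    s.restrict (box κ) (isSemialgebraic_ratBox (lo κ) (hi κ)) (hbox_dom κ)
  have hsum : of s - ∑ κ, of (piece κ) ∈ relations := by
    refine of_sub_sum_of_mem_relations (Finset.univ : Finset (Fin n → Fin N)) s piece ?_ ?_ ?_ ?_
    · intro κ _
      rw [Set.sdiff_eq_empty.2 (show (piece κ).domain ⊆ s.domain from hbox_dom κ), measure_empty]
    · intro κ _ z _; rfl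
    · rw [Set.sdiff_eq_empty.2 ?_, measure_empty]
      intro x hx
      rw [hsd] at hx
      obtain ⟨κ, hκ⟩ := hcover x hx
      exact Set.mem_iUnion₂.2 ⟨κ, Finset.mem_univ κ, hκ⟩
    · intro κ _ κ' _ hne
      exact hnull κ κ' hne
  -- every box is treated by `PiRationalisationEtale`
  have hK : ∀ κ, PiRatAt n (piece κ) := by
    intro κ
    have hdomκ : (piece κ).domain = box κ := rfl
    have hbV' : (piece κ).domain ⊆ V κ := by rw [hdomκ, hboxeq]; exact hbV κ
    have hmem : ∀ {x}, x ∈ (piece κ).domain →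
        x ∈ Set.pi Set.univ (fun i : Fin n => Set.Icc (((κ i : ℕ) : ℝ) / N) ((((κ i : ℕ) : ℝ) + 1) / N)) := by
      intro x hx; rw [hdomκ, hboxeq] at hx; exact hx
    refine hE n (h κ) (V κ) (piece κ) (F κ) (A κ) (B κ) (lo κ) (hi κ) (hV κ) (hlohi κ) rfl hbV' (hhs κ) (hha κ)
      ?_ ?_ ?_ ?_
    · intro x hx; exact (hloc κ x (hmem hx)).1
    · intro x hx; exact (hloc κ x (hmem hx)).2.1
    · intro x hx; exact (hloc κ x (hmem hx)).2.2.1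
    · intro x hx
      have hx' : x ∈ Set.pi Set.univ (fun _ : Fin n => Set.Icc (0:ℝ) 1) := hbox_cube κ (hdomκ ▸ hx)
      show s.integrand x = _
      rw [hsg x hx', (hloc κ x (hmem hx)).2.2.2]
  choose K₀ hK₀ using hK
  refine ⟨Finset.univ.sup K₀, fun K hKle => ?_⟩
  have hsplit : of s = (of s - ∑ κ, of (piece κ)) + ∑ κ, of (piece κ) := by abel
  rw [hsplit, piIter_add, piIter_sum]
  refine add_mem (AddSubgroup.mem_sup_left (piRep_mul_iterate_mem_relations _ hsum)) ?_
  refine AddSubgroup.sum_mem _ fun κ _ => ?_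
  exact hK₀ κ K (le_trans (Finset.le_sup (Finset.mem_univ κ)) hKle)

/-- The per-integrand glue with item 29429 discharged BY NAME (`piRationalisationEtale_proof`, CLOSED):
an étale grid cover of the integrand alone puts `[π]^K·[s]` into the rational-cube sector. -/
theorem piRatAt_of_etaleCoverAt' {n : ℕ} {g : (Fin n → ℝ) → ℝ} (s : IntegralRep n)
    (hsd : s.domain = Set.pi Set.univ (fun _ : Fin n => Set.Icc (0:ℝ) 1))
    (hsg : ∀ z ∈ Set.pi Set.univ (fun _ : Fin n => Set.Icc (0:ℝ) 1), s.integrand z = g z)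
    (hc : EtaleCoverAt n g) : PiRatAt n s :=
  piRatAt_of_etaleCoverAt piRationalisationEtale_proof s hsd hsg hc

/-! ### §1c  The new piece `CubeEtaleNormalForm` and the re-glued deciding theorem -/

/-- **NEW PIECE `CubeEtaleNormalForm` (ÉTALE CUBE NORMAL FORM).**  Every difference of KZ-rational
representations is KZ-equivalent to a ℤ-combination of closed-unit-cube representations `[[0,1]ⁿⁱ, gᵢ]`
whose integrands `gᵢ` are ℚ-Nash near the closed cube AND come with an étale re-presentation on a rational
grid: a mesh `1/Nᵢ` and, on every grid box, `gᵢ = A(x,h x)/B(x,h x)` with `h` a SIMPLE ℚ-Nash branch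
(`F(x,h x) = 0`, `∂_w F(x,h x) ≠ 0`, `B(x,h x) ≠ 0` on the closed box; `F A B ∈ ℚ[x,w]`).
It is the δ-expansion of `CubeNashNormalForm ∧ (EtaleCoverAt of every output integrand)`; text written in
route-decl style (fully qualified, no local defs) so that it can be filed verbatim. -/
def CubeEtaleNormalForm : Prop :=
  ∀ (k k' : ℕ) (r : Literature.NumberTheory.Transcendental.KZ.IntegralRep k) (r' : Literature.NumberTheory.Transcendental.KZ.IntegralRep k'), r.IsRational → r'.IsRational → ∃ (S : ℕ) (n : Fin S → ℕ) (g : (i : Fin S) → (Fin (n i) → ℝ) → ℝ) (U : (i : Fin S) → Set (Fin (n i) → ℝ)) (ε : Fin S → ℤ) (s : (i : Fin S) → Literature.NumberTheory.Transcendental.KZ.IntegralRep (n i)), (∀ i, IsOpen (U i) ∧ Set.pi Set.univ (fun _ : Fin (n i) => Set.Icc (0:ℝ) 1) ⊆ (U i) ∧ Literature.NumberTheory.Transcendental.IsSemialgebraicFunOn ℚ (U i) (g i) ∧ AnalyticOnNhd ℝ (g i) (U i) ∧ ∃ N : ℕ, 0 < N ∧ ∀ κ : Fin (n i) → Fin N,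 ∃ (V : Set (Fin (n i) → ℝ)) (h : (Fin (n i) → ℝ) → ℝ) (F A B : MvPolynomial (Fin (n i + 1)) ℚ), IsOpen V ∧ Set.pi Set.univ (fun j : Fin (n i) => Set.Icc (((κ j : ℕ) : ℝ) / N) ((((κ j : ℕ) : ℝ) + 1) / N)) ⊆ V ∧ Literature.NumberTheory.Transcendental.IsSemialgebraicFunOn ℚ V h ∧ AnalyticOnNhd ℝ h V ∧ (∀ x ∈ Set.pi Set.univ (fun j : Fin (n i) => Set.Icc (((κ j : ℕ) : ℝ) / N) ((((κ j : ℕ) : ℝ) + 1) / N)), MvPolynomial.aeval (Fin.snoc x (h x) : Fin (n i + 1) → ℝ) F = 0 ∧ MvPolynomial.aeval (Fin.snoc x (h x) : Fin (n i + 1) → ℝ) (MvPolynomial.pderiv (Fin.last (n i)) F) ≠ 0 ∧ MvPolynomial.aeval (Fin.snoc x (h x) : Fin (n i + 1) → ℝ) B ≠ 0 ∧ g i x = MvPolynomial.aeval (Fin.snoc x (h x) : Fin (n i + 1) → ℝ) A / MvPolynomial.aeval (Fin.snoc x (h x) : Fin (n i + 1) → ℝ) B)) ∧ (∀ i, (s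 i).domain = Set.pi Set.univ (fun _ : Fin (n i) => Set.Icc (0:ℝ) 1) ∧ ∀ z ∈ Set.pi Set.univ (fun _ : Fin (n i) => Set.Icc (0:ℝ) 1), (s i).integrand z = g i z) ∧ Literature.NumberTheory.Transcendental.KZ.of r - Literature.NumberTheory.Transcendental.KZ.of r' - ∑ i, ε i • Literature.NumberTheory.Transcendental.KZ.of (s i) ∈ Literature.NumberTheory.Transcendental.KZ.relations

/-- Structured reading of the new piece (definitional): the fifth conjunct per integrand is `EtaleCoverAt`. -/
theorem cubeEtaleNormalForm_iff :
    CubeEtaleNormalForm ↔ ∀ (k k' : ℕ) (r : IntegralRep k) (r' : IntegralRep k'), r.IsRational → r'.IsRational →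
      ∃ (S : ℕ) (n : Fin S → ℕ) (g : (i : Fin S) → (Fin (n i) → ℝ) → ℝ) (U : (i : Fin S) → Set (Fin (n i) → ℝ))
        (ε : Fin S → ℤ) (s : (i : Fin S) → IntegralRep (n i)),
        (∀ i, IsOpen (U i) ∧ Set.pi Set.univ (fun _ : Fin (n i) => Set.Icc (0:ℝ) 1) ⊆ (U i) ∧
          IsSemialgebraicFunOn ℚ (U i) (g i) ∧ AnalyticOnNhd ℝ (g i) (U i) ∧ EtaleCoverAt (n i) (g i)) ∧
        (∀ i, (s i).domain = Set.pi Set.univ (fun _ : Fin (n i) => Set.Icc (0:ℝ) 1) ∧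
          ∀ z ∈ Set.pi Set.univ (fun _ : Fin (n i) => Set.Icc (0:ℝ) 1), (s i).integrand z = g i z) ∧
        of r - of r' - ∑ i, ε i • of (s i) ∈ relations :=
  Iff.rfl

/-- Edge 1 (projection): the new piece implies crux 24904 `CubeNashNormalForm`. -/
theorem cubeNashNormalForm_of_etale (hE : CubeEtaleNormalForm) : CubeNashNormalForm := by
  intro k k' r r' hr hr'
  obtain ⟨S, n, g, U, ε, s, hg, hs, hrel⟩ := hE k k' r r' hr hr'
  exact ⟨S, n, g, U, ε, s, fun i => ⟨(hg i).1, (hg i).2.1, (hg i).2.2.1, (hg i).2.2.2.1⟩, hs, hrel⟩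

/-- Edge 2: the OLD pair (crux 24904, support 29430) implies the new piece — so `CubeEtaleNormalForm` is
NOT stronger than the current AND-node `CubeNashNormalForm ∧ NashEtaleCover` (⟹ `∧ PiRationalisation`). -/
theorem cubeEtaleNormalForm_of_nash_of_cover (hN : CubeNashNormalForm) (hC : NashEtaleCover) :
    CubeEtaleNormalForm := by
  intro k k' r r' hr hr'
  obtain ⟨S, n, g, U, ε, s, hg, hs, hrel⟩ := hN k k' r r' hr hr'
  exact ⟨S, n, g, U, ε, s, fun i => ⟨(hg i).1, (hg i).2.1, (hg i).2.2.1, (hg i).2.2.2,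
    hC (n i) (g i) (U i) (hg i).1 (hg i).2.1 (hg i).2.2.1 (hg i).2.2.2⟩, hs, hrel⟩

/-- Edge 2′: given crux 24904 (a THEOREM in the tree — shared item 3574, Jung line, closed 2026-08-17:
`Summit.KontsevichZagierPeriods.SymplecticScissors.CubeNashNormalForm.cubeNashNormalForm_proof` proves the
byte-identical route-B decl by `δ`-conversion; see the companion file `CubeNashNormalFormRouteB.lean`, kept
separate only because its import chain `…SymplecticScissorsCubeNashNormalForm` is heavy), support 29430 ALONE
gives the new piece. -/
theorem cubeEtaleNormalForm_of_cover (hN : CubeNashNormalForm) (hC : NashEtaleCover) : CubeEtaleNormalForm :=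
  cubeEtaleNormalForm_of_nash_of_cover hN hC

/-- Edge 2″: … hence support 31659 `NashEtaleLocal` gives it (landed Lebesgue glue `nashEtaleCover_of_nashEtaleLocal`). -/
theorem cubeEtaleNormalForm_of_local (hN : CubeNashNormalForm) (hL : NashEtaleLocal) : CubeEtaleNormalForm :=
  cubeEtaleNormalForm_of_cover hN (nashEtaleCover_of_nashEtaleLocal hL)

/-- **THE RE-GLUED DECIDING THEOREM OF THIS NODE.**  `CubeEtaleNormalForm`, the π-local rational-cube
kernel (crux 24905) and π-cancellation (24906) decide the summit — the π-rationalisation crux 24903 and its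
whole support tower (29430 NashEtaleCover ⟸ 31659 NashEtaleLocal ⟺ 33042 MultiGenSpecial = Artin–Mazur)
are NOT hypotheses: the étale data travel with the integrands and item 29429 (CLOSED) does the rest.
Proof = the route's `closes` with `hR` replaced by the per-integrand glue `piRatAt_of_etaleCoverAt'`. -/
theorem closes_etale (hE : CubeEtaleNormalForm) (hA : RationalCubePiKernel) (hC : KontsevichZagierPeriods.Theses.RootDecompRationalCubeDichotomy.PiCancellation) :
    _root_.KontsevichZagierPeriods := by
  rw [KontsevichZagierPeriods_iff]
  intro n m r r' hr hr' hv
  -- eval of the iterate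
  have heval : ∀ (K : ℕ) (x : FormalRep),
      KZ.eval ((fun y : FormalRep => of piRep * y)^[K] x) = Real.pi ^ K * KZ.eval x := by
    intro K x
    induction K with
    | zero => simp
    | succ K ih => rw [Function.iterate_succ_apply', KZ.eval_piRep_mul, ih, pow_succ]; ring
  -- étale cube normal form and π-rationalisation of each cube, per integrand
  obtain ⟨S, nS, g, U, ε, s, hNash, hs, hrel⟩ := hE n m r r' hr hr'
  choose K₀ hK₀ using fun i : Fin S =>
    piRatAt_of_etaleCoverAt' (g := g i) (s i) (hs i).1 (hs i).2 (hNash i).2.2.2.2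
  -- a `[π]`-power multiple of `[r] - [r']` is a relation
  have hK : ∃ N : ℕ, (fun y : FormalRep => of piRep * y)^[N]
      ((fun y : FormalRep => of piRep * y)^[Finset.univ.sup K₀] (of r - of r')) ∈ relations := by
    refine hA _ ?_ ?_
    · have hsplit : of r - of r' = (of r - of r' - ∑ i, ε i • of (s i)) + ∑ i, ε i • of (s i) := by abel
      rw [hsplit, piIter_add, piIter_sum]
      refine AddSubgroup.add_mem _ (AddSubgroup.mem_sup_left (piRep_mul_iterate_mem_relations _ hrel)) ?_
      refine AddSubgroup.sum_mem _ fun i _ => ?_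
      let φ : FormalRep →+ FormalRep := AddMonoidHom.mk' _ (piIter_add (Finset.univ.sup K₀))
      have hφ : ∀ x, φ x = (fun y : FormalRep => of piRep * y)^[Finset.univ.sup K₀] x := fun x => rfl
      rw [← hφ, map_zsmul, hφ]
      exact AddSubgroup.zsmul_mem _ (hK₀ i _ (Finset.le_sup (Finset.mem_univ i))) _
    · rw [heval, map_sub, KZ.eval_of, KZ.eval_of, hv, sub_self, mul_zero]
  -- π-cancellation removes the power
  have hcancel : ∀ (K : ℕ) (c : FormalRep),
      (fun y : FormalRep => of piRep * y)^[K] c ∈ relations → c ∈ relations := by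
    intro K
    induction K with
    | zero => intro c h; exact h
    | succ K ih =>
      intro c h
      apply ih
      rw [Function.iterate_succ_apply'] at h
      exact hC _ h
  obtain ⟨N, hN'⟩ := hK
  rw [← Function.iterate_add_apply] at hN'
  exact hcancel _ _ hN'

/-- The re-glued deciding theorem with the summit decl spelled out (gate-visible form). -/
theorem closes_etale' :
    CubeEtaleNormalForm → RationalCubePiKernel → KontsevichZagierPeriods.Theses.RootDecompRationalCubeDichotomy.PiCancellation → _root_.KontsevichZagierPeriods :=
  closes_etale

end Summit.KontsevichZagierPeriods.RootDecompRationalCubeDichotomy.Rung24903.EtaleBypass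
end
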